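import Summits.QuantumAdvantage.QuantumAdvantage.Theorems.CubicForrelationNearExactIsExactTwoModSixBoundary
import Summits.QuantumAdvantage.QuantumAdvantage.Theorems.CubicForrelationNearExactIsExactZeroModSixBoundary
import Summits.QuantumAdvantage.QuantumAdvantage.Theorems.CubicForrelationNearExactIsExactFourModSixBoundary
import Summits.QuantumAdvantage.QuantumAdvantage.Theorems.CubicForrelationNearExactIsExactEightThirteenSixteenths
import Summits.QuantumAdvantage.QuantumAdvantage.Theorems.CubicForrelationNearExactIsExactTenSevenEighths

/-!
# Crux `CubicForrelation.NearExactIsExact` (stmt-QuantumAdvantage-14043) — the uniform one-sided rate is STRICT: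
  for every even `n ≥ 8`, `θ_n < 1 − 2^{−⌊n/3⌋−1}` (the boundary value of `isolation_rate_even` is never attained)

Certificate seat `b2b-cforr-cert` (gen 6).  HONEST FRAMING: this packages infinitely many finite-slice verdicts as ONE theorem uniform in `n`
(`isolation_rate_closed`: for all even `n ≥ 8` and all cubic `f, g : 𝔽₂ⁿ → 𝔽₂`, `Φ(f,g) ≥ 1 − 2^{−(⌊n/3⌋+1)} ⇒ Φ(f,g) = 1`, i.e. the tree's
`isolation_rate_even` with `≤` in place of `<`).  It is NOT summit progress: the improved constants still tend to `1`, while the crux asks for a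
single `θ < 1` for all `n`; the tree's lower bound `θ_n ≥ 15/16` (`n ≥ 16`) is untouched.

Assembly by residue class: `n ≡ 0 (mod 6)`, `n ≥ 12` — `isolation_rate_closed_zero_mod_six`; `n ≡ 2 (mod 6)`, `n ≥ 14` —
`isolation_rate_closed_two_mod_six`; `n ≡ 4 (mod 6)`, `n ≥ 16` — `isolation_rate_closed_four_mod_six` (all two-sided: budget identity, affine
level parity, general flat sums localised to the odd coset, and the rank-`≤ 2` spectral engine `fl1_flat_l1` against the pairing identity); the
small cases `n = 8, 10` are the sharper landed rungs `isolation_eight_1316` (`θ₈ = 13/16 < 7/8`) and `isolation_ten_78_digital` (`θ₁₀ = 7/8 < 15/16`).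
Corollary `theta_lt_rate`.  (`n = 6` is not covered here.)

References: as in the imported files.  Everything below is proved from the tree; axioms are the standard three.
-/

set_option linter.dupNamespace false -- D-0017: single-problem summit ⇒ `QuantumAdvantage.QuantumAdvantage` by design

noncomputable section

namespace Summit.QuantumAdvantage.QuantumAdvantage.Theorems.CubicForrelation.NearExactIsExact

open Finset
open Literature.Computability.QuantumComplexity

/-- **The uniform rate is strict.**  For every even `n ≥ 8` and all cubic `f, g : 𝔽₂ⁿ → 𝔽₂`:
`Φ(f,g) ≥ 1 − 2^{−(⌊n/3⌋+1)} ⇒ Φ(f,g) = 1` (at the literal type `Fin n`).  Infinitely many finite-slice verdicts in one statement;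
NOT summit progress (the constants tend to `1`). [this work] -/
theorem isolation_rate_closed : ∀ n : ℕ, Even n → 8 ≤ n → ∀ f g : (Fin n → Bool) → Bool,
    IsDegLeFun 3 f → IsDegLeFun 3 g → 1 - (1 / 2 : ℝ) ^ (n / 3 + 1) ≤ forrelation f g → forrelation f g = 1 := by
  intro n he h8 f g hf hg hΦ
  obtain ⟨m, rfl⟩ := he
  obtain h | h | h : m = 4 ∨ m = 5 ∨ 6 ≤ m := by omega
  · subst h
    have e : (1 : ℝ) - (1 / 2) ^ ((4 + 4) / 3 + 1) = 7 / 8 := by norm_num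
    rw [e] at hΦ
    exact isolation_eight_1316 f g hf hg (by linarith)
  · subst h
    have e : (1 : ℝ) - (1 / 2) ^ ((5 + 5) / 3 + 1) = 15 / 16 := by norm_num
    rw [e] at hΦ
    exact isolation_ten_78_digital f g hf hg (by linarith)
  · obtain h0 | h2 | h4 : (m + m) % 6 = 0 ∨ (m + m) % 6 = 2 ∨ (m + m) % 6 = 4 := by omega
    · exact isolation_rate_closed_zero_mod_six (m + m) h0 (by omega) f g hf hg hΦ
    · exact isolation_rate_closed_two_mod_six (m + m) h2 (by omega) f g hf hg hΦ
    · exact isolation_rate_closed_four_mod_six (m + m) h4 (by omega) f g hf hg hΦ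

/-- **`θ_n < 1 − 2^{−(⌊n/3⌋+1)}` for every even `n ≥ 8`:** some `θ` strictly below the uniform rate already isolates `Φ = 1` among cubic
pairs on `n` bits.  NOT summit progress. [this work] -/
theorem theta_lt_rate (n : ℕ) (he : Even n) (h8 : 8 ≤ n) :
    ∃ θ : ℝ, θ < 1 - (1 / 2 : ℝ) ^ (n / 3 + 1) ∧ ∀ f g : (Fin n → Bool) → Bool, IsDegLeFun 3 f → IsDegLeFun 3 g →
      θ < forrelation f g → forrelation f g = 1 :=
  fb_theta_lt_of_closed (n := n) _ (isolation_rate_closed n he h8)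

end Summit.QuantumAdvantage.QuantumAdvantage.Theorems.CubicForrelation.NearExactIsExact

end
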